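import Literature.NumberTheory.Automorphic.BrandtXiSetupIndependence
import HarnessLib

/-!
# The Brandt module of level `(N⁺, N⁻)` is canonical up to isomorphism of Brandt data

Topic `NumberTheory/Automorphic`; theorems only (no definition, no named fact, no instance).
`brandtModule N⁺ N⁻` (`BrandtModule.lean`) is the Brandt data `(Cls O, w, B(·))` of an Eichler
package of level `(N⁺, N⁻)` — a definite quaternion algebra `B` over `ℚ` ramified exactly at the
primes dividing `N⁻`, with an Eichler order `O` of level `N⁺` — chosen by `Classical.choice`; its
docstring promises: "the result depends on the choices only up to isomorphism of Brandt data (all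
Eichler orders of a given level are locally conjugate and linked by an ideal, Vignéras III §5
Cor. 5.5 ff.), to be recorded as a theorem". This file records that theorem:

* `BrandtData.ofOrder_iso_of_ringEquiv` — the Brandt data (in the vocabulary of `BrandtModule.lean`:
  `RightIdealClass`, stabiliser weights, `subidealCount`) of `O` and of `e(O)` for a ring
  isomorphism `e` are isomorphic;
* `EichlerPackage.nonempty_algEquiv` — the algebras of two packages of the same level are
  isomorphic (`nonempty_algEquiv_of_ramifiedPlaces_eq_holds`);
* after this identification the two Eichler orders are locally conjugate at every prime
  (`IsEichlerOrder.exists_locallyConjugate`, `BrandtXiSetupIndependence.lean` /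
  `EichlerOrderLocalConjugacy.lean`), hence connected (`ConnectingIdeal.lean`);
* `EichlerPackage.exists_brandtDataIso` — **the Brandt data of any two Eichler packages of level
  `(N⁺, N⁻)` are isomorphic**: `∃ ε : Cls O ≃ Cls O', w' (ε i) = w i ∧ T' n (ε i) (ε j) = T n i j`;
* `exists_brandtModule_iso` — **`brandtModule N⁺ N⁻` is isomorphic to the Brandt data of every
  Eichler package of level `(N⁺, N⁻)`**; `EichlerPackage.classNumber_eq` — the class number is
  well defined.

## References

* M. Eichler, *The basis problem for modular forms and the traces of the Hecke operators*, LNM 320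
  (1973), Ch. II §6 [Eichler1973].
* M.-F. Vignéras, *Arithmétique des algèbres de quaternions*, LNM 800 (1980), Ch. III §3
  Thm. 3.1, §5 B and Cor. 5.5 ff. [VignerasLNM800].
-/

noncomputable section

open scoped Pointwise
open NumberField IsDedekindDomain

universe u v

namespace Literature.NumberTheory.Automorphic

/-! ### Transport of the Brandt data of `BrandtModule.lean` along a ring isomorphism -/

section RingEquiv

variable {B : Type u} {B' : Type v} [Ring B] [Ring B']

/-- `O_r(e(I)) = e(O_r(I))` (`rightOrderOf` of `BrandtModule.lean`). [folklore] -/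
theorem rightOrderOf_map_ringEquiv (e : B ≃+* B') (I : Submodule ℤ B) :
    rightOrderOf (I.map (e.toAddEquiv.toIntLinearEquiv : B →ₗ[ℤ] B')) =
      (rightOrderOf I).map (e.toAddEquiv.toIntLinearEquiv : B →ₗ[ℤ] B') :=
  Brandt.rightOrder_map_ringEquiv e I

/-- `O_ℓ(e(I)) = e(O_ℓ(I))` (`leftOrderOf` of `BrandtModule.lean`). [folklore] -/
theorem leftOrderOf_map_ringEquiv (e : B ≃+* B') (I : Submodule ℤ B) :
    leftOrderOf (I.map (e.toAddEquiv.toIntLinearEquiv : B →ₗ[ℤ] B')) =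
      (leftOrderOf I).map (e.toAddEquiv.toIntLinearEquiv : B →ₗ[ℤ] B') :=
  Brandt.leftOrder_map_ringEquiv e I

/-- `e` carries `ℤ`-orders to `ℤ`-orders. [folklore] -/
theorem IsZOrder.map_ringEquiv (e : B ≃+* B') {O : Submodule ℤ B} (hO : IsZOrder O) :
    IsZOrder (O.map (e.toAddEquiv.toIntLinearEquiv : B →ₗ[ℤ] B')) where
  one_mem := by
    rw [mem_map_ringEquiv_iff, map_one]
    exact hO.one_mem
  mul_mem a ha b hb := by
    rw [mem_map_ringEquiv_iff] at ha hb ⊢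
    rw [map_mul]
    exact hO.mul_mem _ ha _ hb
  isFullLattice := hO.isFullLattice.map_ringEquiv e

/-- `e` carries invertible right `O`-ideals to invertible right `e(O)`-ideals. [folklore] -/
theorem IsInvertibleRightIdeal.map_ringEquiv (e : B ≃+* B') {O I : Submodule ℤ B}
    (h : IsInvertibleRightIdeal O I) :
    IsInvertibleRightIdeal (O.map (e.toAddEquiv.toIntLinearEquiv : B →ₗ[ℤ] B'))
      (I.map (e.toAddEquiv.toIntLinearEquiv : B →ₗ[ℤ] B')) where
  isFullLattice := h.isFullLattice.map_ringEquiv e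
  rightOrderOf_eq := by rw [rightOrderOf_map_ringEquiv, h.rightOrderOf_eq]
  exists_inv := by
    obtain ⟨I', h₁, h₂⟩ := h.exists_inv
    refine ⟨I'.map (e.toAddEquiv.toIntLinearEquiv : B →ₗ[ℤ] B'), ?_, ?_⟩
    · rw [← map_ringEquiv_mul, h₁, leftOrderOf_map_ringEquiv]
    · rw [← map_ringEquiv_mul, h₂]

/-- The inverse direction: `e⁻¹(I')` is an invertible right `O`-ideal if `I'` is an invertible
right `e(O)`-ideal. [folklore] -/
theorem IsInvertibleRightIdeal.map_ringEquiv_symm (e : B ≃+* B') {O : Submodule ℤ B}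
    {I' : Submodule ℤ B'}
    (h : IsInvertibleRightIdeal (O.map (e.toAddEquiv.toIntLinearEquiv : B →ₗ[ℤ] B')) I') :
    IsInvertibleRightIdeal O (I'.map (e.symm.toAddEquiv.toIntLinearEquiv : B' →ₗ[ℤ] B)) := by
  have h' := h.map_ringEquiv e.symm
  rwa [map_ringEquiv_symm_map] at h'

/-- `[e(I)] = [e(J)] ↔ [I] = [J]` for invertible right ideals. [folklore] -/
theorem RightIdealClass.mk_map_ringEquiv_eq_iff (e : B ≃+* B') {O : Submodule ℤ B}
    (I J : invertibleRightIdeals O) :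
    RightIdealClass.mk (O := O.map (e.toAddEquiv.toIntLinearEquiv : B →ₗ[ℤ] B'))
        ⟨_, I.2.map_ringEquiv e⟩ =
      RightIdealClass.mk (O := O.map (e.toAddEquiv.toIntLinearEquiv : B →ₗ[ℤ] B'))
        ⟨_, J.2.map_ringEquiv e⟩ ↔
      RightIdealClass.mk I = RightIdealClass.mk J := by
  rw [RightIdealClass.mk_eq_mk_iff, RightIdealClass.mk_eq_mk_iff]
  change (∃ b : B'ˣ, (J : Submodule ℤ B).map _ = b • (I : Submodule ℤ B).map _) ↔
    ∃ b : Bˣ, (J : Submodule ℤ B) = b • (I : Submodule ℤ B)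
  constructor
  · rintro ⟨b, hb⟩
    refine ⟨Units.map (e.symm : B' →* B) b, map_ringEquiv_injective e ?_⟩
    rw [hb, map_ringEquiv_units_smul, unitsMap_ringEquiv_symm_apply]
  · rintro ⟨b, hb⟩
    exact ⟨Units.map (e : B →* B') b, by rw [hb, map_ringEquiv_units_smul]⟩

/-- The stabilisers of `I` and `e(I)` in the unit groups are equinumerous (`u ↦ e(u)`). [folklore] -/
theorem card_stabilizer_map_ringEquiv (e : B ≃+* B') (I : Submodule ℤ B) :
    Nat.card (MulAction.stabilizer B'ˣ (I.map (e.toAddEquiv.toIntLinearEquiv : B →ₗ[ℤ] B'))) =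
      Nat.card (MulAction.stabilizer Bˣ I) := by
  refine (Nat.card_congr (Equiv.subtypeEquiv (Units.mapEquiv e.toMulEquiv).toEquiv fun u => ?_)).symm
  change u ∈ MulAction.stabilizer Bˣ I ↔
    Units.map (e : B →* B') u ∈ MulAction.stabilizer B'ˣ (I.map _)
  rw [MulAction.mem_stabilizer_iff, MulAction.mem_stabilizer_iff, ← map_ringEquiv_units_smul]
  exact ⟨fun h => by rw [h], fun h => map_ringEquiv_injective e h⟩

/-- The sub-ideal counts agree: `subidealCount e(O) e(I) n [e(K)] = subidealCount O I n [K]`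
(`M ↦ e(M)` is a bijection on the sub-ideals counted). [folklore] -/
theorem subidealCount_map_ringEquiv (e : B ≃+* B') {O : Submodule ℤ B} (I : Submodule ℤ B) (n : ℕ)
    (K : invertibleRightIdeals O) :
    subidealCount (O.map (e.toAddEquiv.toIntLinearEquiv : B →ₗ[ℤ] B'))
        (I.map (e.toAddEquiv.toIntLinearEquiv : B →ₗ[ℤ] B')) n
        (RightIdealClass.mk ⟨_, K.2.map_ringEquiv e⟩) =
      subidealCount O I n (RightIdealClass.mk K) := by
  unfold subidealCount
  refine (Nat.card_congr ?_).symm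
  refine
    { toFun := fun M => ⟨⟨_, M.1.2.map_ringEquiv e⟩, Submodule.map_mono M.2.1, ?_, ?_⟩
      invFun := fun M => ⟨⟨(M.1 : Submodule ℤ B').map (e.symm.toAddEquiv.toIntLinearEquiv : B' →ₗ[ℤ] B),
          M.1.2.map_ringEquiv_symm e⟩, ?_, ?_, ?_⟩
      left_inv := fun M => Subtype.ext (Subtype.ext (map_ringEquiv_symm_map e (M.1 : Submodule ℤ B)))
      right_inv := fun M => Subtype.ext (Subtype.ext (map_map_ringEquiv_symm e (M.1 : Submodule ℤ B'))) }
  · rw [relIndex_map_ringEquiv]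
    exact M.2.2.1
  · rw [RightIdealClass.mk_map_ringEquiv_eq_iff]
    exact M.2.2.2
  · have h := Submodule.map_mono (f := (e.symm.toAddEquiv.toIntLinearEquiv : B' →ₗ[ℤ] B)) M.2.1
    rwa [map_ringEquiv_symm_map] at h
  · have h := relIndex_map_ringEquiv e.symm (M.1 : Submodule ℤ B')
      (I.map (e.toAddEquiv.toIntLinearEquiv : B →ₗ[ℤ] B'))
    rw [map_ringEquiv_symm_map] at h
    rw [h]
    exact M.2.2.1
  · -- classes: `[e⁻¹(M)] = [K] ↔ [M] = [e(K)]`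
    have h := (RightIdealClass.mk_map_ringEquiv_eq_iff e
      ⟨(M.1 : Submodule ℤ B').map (e.symm.toAddEquiv.toIntLinearEquiv : B' →ₗ[ℤ] B),
        M.1.2.map_ringEquiv_symm e⟩ K).mp
    refine h ?_
    have hM : (((M.1 : Submodule ℤ B').map (e.symm.toAddEquiv.toIntLinearEquiv : B' →ₗ[ℤ] B)).map
        (e.toAddEquiv.toIntLinearEquiv : B →ₗ[ℤ] B')) = (M.1 : Submodule ℤ B') :=
      map_map_ringEquiv_symm e _
    have : (⟨_, (M.1.2.map_ringEquiv_symm e).map_ringEquiv e⟩ :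
        invertibleRightIdeals (O.map (e.toAddEquiv.toIntLinearEquiv : B →ₗ[ℤ] B'))) = M.1 :=
      Subtype.ext hM
    rw [this]
    exact M.2.2.2

variable [Algebra ℚ B] [IsQuaternionAlgebra ℚ B] [Algebra ℚ B'] [IsQuaternionAlgebra ℚ B']

/-- **The Brandt data of `O` and `e(O)` are isomorphic** (vocabulary of `BrandtModule.lean`): for a
`ℤ`-order `O` of a quaternion algebra over `ℚ` and a ring isomorphism `e : B ≃ B'` there is
`ε : Cls O ≃ Cls e(O)`, `ε [I] = [e(I)]`, with `w (ε i) = w i` and `T n (ε i) (ε j) = T n i j`.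
[cite: Eichler1973, Ch. II §6 (14)–(15)] -/
theorem BrandtData.ofOrder_iso_of_ringEquiv (e : B ≃+* B') {O : Submodule ℤ B} (hO : IsZOrder O) :
    ∃ ε : RightIdealClass O ≃ RightIdealClass (O.map (e.toAddEquiv.toIntLinearEquiv : B →ₗ[ℤ] B')),
      (∀ I : invertibleRightIdeals O,
        ε (RightIdealClass.mk I) = RightIdealClass.mk ⟨_, I.2.map_ringEquiv e⟩) ∧
      (∀ i, (BrandtData.ofOrder _ (hO.map_ringEquiv e)).w (ε i) = (BrandtData.ofOrder O hO).w i) ∧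
      ∀ n i j, (BrandtData.ofOrder _ (hO.map_ringEquiv e)).T n (ε i) (ε j) =
        (BrandtData.ofOrder O hO).T n i j := by
  let ε₀ : invertibleRightIdeals O ≃
      invertibleRightIdeals (O.map (e.toAddEquiv.toIntLinearEquiv : B →ₗ[ℤ] B')) :=
    { toFun := fun I => ⟨_, I.2.map_ringEquiv e⟩
      invFun := fun I' => ⟨_, I'.2.map_ringEquiv_symm e⟩
      left_inv := fun I => Subtype.ext (map_ringEquiv_symm_map e I.1)
      right_inv := fun I' => Subtype.ext (map_map_ringEquiv_symm e I'.1) }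
  let ε : RightIdealClass O ≃ RightIdealClass (O.map (e.toAddEquiv.toIntLinearEquiv : B →ₗ[ℤ] B')) :=
    Quotient.congr ε₀ fun I J => by
      exact (RightIdealClass.mk_eq_mk_iff (I := I) (J := J)).symm.trans
        ((RightIdealClass.mk_map_ringEquiv_eq_iff e I J).symm.trans RightIdealClass.mk_eq_mk_iff)
  have hε : ∀ I : invertibleRightIdeals O,
      ε (RightIdealClass.mk I) = RightIdealClass.mk ⟨_, I.2.map_ringEquiv e⟩ :=
    fun I => Quotient.congr_mk _ _ _
  refine ⟨ε, hε, fun i => ?_, fun n i j => ?_⟩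
  · obtain ⟨I, rfl⟩ := RightIdealClass.mk_surjective i
    rw [hε, BrandtData.ofOrder_w_mk, BrandtData.ofOrder_w_mk]
    exact congrArg (· / 2) (card_stabilizer_map_ringEquiv e (I : Submodule ℤ B))
  · obtain ⟨I, rfl⟩ := RightIdealClass.mk_surjective i
    obtain ⟨J, rfl⟩ := RightIdealClass.mk_surjective j
    rw [hε, hε, BrandtData.ofOrder_T_mk, BrandtData.ofOrder_T_mk]
    exact congrArg Nat.cast (subidealCount_map_ringEquiv e (I : Submodule ℤ B) n J)

end RingEquiv

/-! ### Eichler packages of the same level -/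

namespace EichlerPackage

variable {Nplus Nminus : ℕ}

/-- The algebras of two Eichler packages of level `(N⁺, N⁻)` are isomorphic (uniqueness of the
quaternion algebra over `ℚ` ramified exactly at the primes dividing `N⁻` and at `∞`,
`nonempty_algEquiv_of_ramifiedPlaces_eq_holds`). [cite: VignerasLNM800, Ch. III §3 Thm. 3.1] -/
theorem nonempty_algEquiv (P P' : EichlerPackage Nplus Nminus) : Nonempty (P.B ≃ₐ[ℚ] P'.B) := by
  refine nonempty_algEquiv_of_ramifiedPlaces_eq_holds ℚ P.B P'.B
    (Set.ext fun v => (P.mem_ramifiedPlaces_iff v).trans (P'.mem_ramifiedPlaces_iff v).symm) ?_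
  rw [show ramifiedInfinitePlaces ℚ P.B = Set.univ from
      Set.eq_univ_iff_forall.mpr fun w => P.isTotallyDefinite w,
    show ramifiedInfinitePlaces ℚ P'.B = Set.univ from
      Set.eq_univ_iff_forall.mpr fun w => P'.isTotallyDefinite w]

/-- The level `N⁺` of an Eichler package is non-zero (a finite index of full lattices). [folklore] -/
theorem nplus_ne_zero (P : EichlerPackage Nplus Nminus) : Nplus ≠ 0 := by
  haveI : IsAddTorsionFree P.B := isAddTorsionFree_of_charZero_module ℚ P.B
  obtain ⟨O₁, O₂, h₁, -, hO12, hidx⟩ := P.isEichlerOrder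
  obtain ⟨n, hn, hnO⟩ := exists_smul_mem_of_fg P.isEichlerOrder.isZOrder.isFullLattice
    h₁.1.isFullLattice.1
  rw [← hidx]
  exact relIndex_ne_zero_of_smul_mem O₁ h₁.1.isFullLattice.1 hn P.O hnO

/-- **The Brandt data of any two Eichler packages of level `(N⁺, N⁻)` are isomorphic**: there is a
bijection `ε : Cls O ≃ Cls O'` of the class sets with `w' (ε i) = w i` and
`T' n (ε i) (ε j) = T n i j` (isomorphism of the algebras, `BrandtData.ofOrder_iso_of_ringEquiv`;
then local conjugacy (`IsEichlerOrder.exists_locallyConjugate`), a connecting ideal and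
`BrandtData.ofOrder_iso_of_locallyConjugate`). This is
the theorem promised by the docstring of `brandtModule`. [cite: VignerasLNM800, Ch. III §5 B and Cor. 5.5] [cite: Eichler1973, Ch. II §6 Thm. 2] -/
theorem exists_brandtDataIso (P P' : EichlerPackage Nplus Nminus) :
    ∃ ε : P.brandtData.ι ≃ P'.brandtData.ι,
      (∀ i, P'.brandtData.w (ε i) = P.brandtData.w i) ∧
      ∀ n i j, P'.brandtData.T n (ε i) (ε j) = P.brandtData.T n i j := by
  obtain ⟨e⟩ := P.nonempty_algEquiv P'
  have hdiv : ∀ y : P'.B, y ≠ 0 → IsUnit y := fun y hy =>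
    isUnit_of_isTotallyDefinite P'.B P'.isTotallyDefinite hy
  have hOZ : IsZOrder P.O := P.isEichlerOrder.isZOrder
  -- transport along `e`
  obtain ⟨ε₁, -, hw₁, hT₁⟩ := BrandtData.ofOrder_iso_of_ringEquiv e.toRingEquiv hOZ
  -- the transported order is an Eichler order of level `N⁺` in `P'.B`, locally conjugate to `P'.O`
  have hO₁ : IsEichlerOrder
      (P.O.map (e.toRingEquiv.toAddEquiv.toIntLinearEquiv : P.B →ₗ[ℤ] P'.B)) Nplus :=
    isEichlerOrder_iff_brandt.mpr
      ((isEichlerOrder_iff_brandt.mp P.isEichlerOrder).map_ringEquiv e.toRingEquiv)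
  obtain ⟨x, T, hT, hconj, heq⟩ := hO₁.exists_locallyConjugate hdiv P'.isEichlerOrder P.nplus_ne_zero
  obtain ⟨ε₂, hw₂, hT₂⟩ := BrandtData.ofOrder_iso_of_locallyConjugate hdiv (hOZ.map_ringEquiv e.toRingEquiv)
    P'.isEichlerOrder.isZOrder x T hT hconj heq
  refine ⟨ε₁.trans ε₂, fun i => ?_, fun n i j => ?_⟩
  · change (BrandtData.ofOrder P'.O P'.isEichlerOrder.isZOrder).w (ε₂ (ε₁ i)) =
      (BrandtData.ofOrder P.O hOZ).w i
    rw [hw₂, hw₁]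
  · change (BrandtData.ofOrder P'.O P'.isEichlerOrder.isZOrder).T n (ε₂ (ε₁ i)) (ε₂ (ε₁ j)) =
      (BrandtData.ofOrder P.O hOZ).T n i j
    rw [hT₂, hT₁]

/-- **The class number of level `(N⁺, N⁻)` is well defined**: any two packages have the same class
number. [cite: VignerasLNM800, Ch. III §5 B] -/
theorem classNumber_eq (P P' : EichlerPackage Nplus Nminus) :
    P'.brandtData.classNumber = P.brandtData.classNumber := by
  obtain ⟨ε, -, -⟩ := P.exists_brandtDataIso P'
  exact (Fintype.card_congr ε).symm

end EichlerPackage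

/-- **`brandtModule N⁺ N⁻` is canonical up to isomorphism of Brandt data**: for every Eichler
package `P` of level `(N⁺, N⁻)` there is `ε : (brandtModule N⁺ N⁻).ι ≃ Cls P.O` carrying the
weights and the Brandt matrices of `brandtModule N⁺ N⁻` to those of `P`. [cite: Eichler1973, Ch. II §6 Thm. 2] [cite: VignerasLNM800, Ch. III §5 B] -/
theorem exists_brandtModule_iso {Nplus Nminus : ℕ} (P : EichlerPackage Nplus Nminus) :
    ∃ ε : (brandtModule Nplus Nminus).ι ≃ P.brandtData.ι,
      (∀ i, P.brandtData.w (ε i) = (brandtModule Nplus Nminus).w i) ∧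
      ∀ n i j, P.brandtData.T n (ε i) (ε j) = (brandtModule Nplus Nminus).T n i j := by
  have h : Nonempty (EichlerPackage Nplus Nminus) := ⟨P⟩
  rw [brandtModule_eq h]
  exact (brandtPackage Nplus Nminus h).exists_brandtDataIso P

end Literature.NumberTheory.Automorphic

end
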